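import Summits.Ventures.HSemireg.SiegelComponentChartAtDoors
import Literature.AlgebraicGeometry.HodgeTheory.SemiregularVariationalHodgeISemiregularModel
import HarnessLib

/-!
# Venture HSemireg — the vector-bundle door (D2) with ONE object on ONE MODEL of the special fibre:
# Buchweitz–Flenner Thm. 5.1 in its model rendering, globalised, on a chart, and on `𝒜_{g,δ,N}` at one component

HONEST FRAMING. Assembly file of the computation cell `pub-hsemireg` (Lean seat p3, composition duty); nothing is claimed
about any variety and nothing here says that HC / HC_CM / HC_AV holds — every theorem carries its inputs BY NAME. No
definition is declared in this file.

The landed vector-bundle doors `hc_on_siegelComponent_of_sheafSeed_of_smul_add{,_at,_of_baseChartAt}`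
(`SiegelComponentChartSheaf.lean`, `SiegelComponentChartAtDoors.lean`) and the chart forms of `ComponentTransferSheaf.lean`
consume the FIXED-FIBRE rendering `BuchweitzFlenner2003_variationalHodge_ISemiregular` of BF Thm. 5.1, whose `ℰ₀` lives on
the tree's chosen fibre `𝒳_{u₀}` of the chart; an object computed on another model `X₀ ≅ 𝒴_{t₀}` of the special fibre could
enter only through a seed quantified over EVERY model (`hseed : ∀ X₀ (e : X₀ ≅ 𝒴_{t₀}), ∃ ℰ₀ …`). The Literature fact
`BuchweitzFlenner2003_variationalHodge_ISemiregular_model` (same theorem, the identification `e : X₀ ≅ 𝒳_{s₀}` of the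
special fibre in its binders — BF work with deformations OF `X₀`, Example 6.2 / 7.18) removes that: this file re-runs the
three layers over it, so that ONE finite locally free `I`-semiregular `ℰ₀` on ONE model `X₀` with ONE iso `e : X₀ ≅ 𝒴_{t₀}`
is the input — the same currency as the cell's lci doors (Bloch's (7.4) carries the model iso likewise) and as theory seat
2's one-model Weil-family door `weilAnchorLocalClause_of_BFmodel_of_sheafSeedOn` (`SheafSeedOnAnchor.lean`).

* `BuchweitzFlenner2003.semiregular_deforms_model` — BF Thm. 5.1 GLOBAL along an irreducible smooth quasi-projective base
  (theory seat 1's `BuchweitzFlenner2003.semiregular_deforms`, same proof) with `ℰ₀` on a model `e : X₀ ≅ 𝒳_{s₀}` and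
  `e^*(W_p|_{𝒳_{s₀}}) = ch_p(ℰ₀)`.
* `forall_mem_algebraicClasses_of_sweepsClasses_sheafOn`, `…_of_smul_add`, `hc_on_component_of_semiregular_sheafOn`,
  `…_of_smul_add` — the chart / component forms of `ComponentTransferSheaf.lean`, one model.
* `hc_on_siegelComponent_of_sheafSeedOn_of_smul_add_at`, `…_of_baseChartAt`, `hc_on_siegelComponent_of_sheafSeedOn_of_smul_add`
  — the 𝒜_g door D2 at one component (chart clause `SiegelHodgeLocusChartAt D p C` / base chart
  `SiegelHodgeLocusBaseChartAt D p C` ∧ `deligne_globalInvariantCycles`) and its universal form, ONE MODEL: the every-model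
  `hseed` of `hc_on_siegelComponent_of_sheafSeed_of_smul_add_at` is replaced by `(X₀) (e : X₀ ≅ 𝒴_{t₀}) (ℰ₀) (hℰ₀) (hsr)
  (hchp) (hchp')` for that one `(X₀, e)`.

SCOPE (as printed vs as typed): as `ComponentTransferSheaf.lean` — `ℰ₀` FINITE LOCALLY FREE and untwisted (BF print
«coherent»); perfect complexes / non-locally-free sheaves have NO door; the companion Chern classes `ch_{p'}(ℰ₀)`,
`p' ∈ I ∖ {p}`, must be met by global fibrewise-`(p',p')` classes. Inputs BY NAME: `hBF :
BuchweitzFlenner2003_variationalHodge_ISemiregular_model` (REFEREED named fact, Literature); the chart clauses (cell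
assumptions, theory seats 2/3); `charlesSchnell_algebraicityLocus_iUnion_closed` and `deligne_globalInvariantCycles` as in the
landed doors. NOT inputs: CM-ness, HC_CM, CM density, MT finiteness.

References: [BuchweitzFlenner2003] Compositio Math. 137 (2003), §5 Thm. 5.1 pp. 174–175, §5 (`I`-semiregular) p. 174,
§6 Example 6.2 p. 180, 7.18 pp. 196–197; [Bloch1972Semiregularity] proof of (7.4), last paragraph, p. 65;
[CharlesSchnell2014Notes] Prop. 11.3.11; [CattaniDeligneKaplan1995JAMS] Thm. 1.1, Cor. 1.2; [DeligneHodgeII1971] Thm. 4.1.1;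
[Markman2025SecantWeil] §1.5 (the shape `q·hⁿ + w`); [FultonYoungTableaux1997] App. B §B.1 (functoriality of `H^*`).
-/

noncomputable section

open CategoryTheory AlgebraicGeometry Set
open Literature.AlgebraicGeometry.Motives Literature.AlgebraicGeometry.HodgeTheory
open Literature.AlgebraicGeometry.ModuliOfAbelianVarieties Literature.AlgebraicGeometry.Deligne1982
open Literature.AlgebraicTopology.SingularHomology

namespace Summit.Ventures.HSemireg

local notation3 (prettyPrint := false) "Res[" f ", " s ", " k ", " A "]" =>
  complexBetti.map (Literature.AlgebraicGeometry.Motives.fiberι f s) k A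

/-! ## 1. Buchweitz–Flenner Thm. 5.1, GLOBAL form, special fibre up to a model isomorphism -/

namespace BuchweitzFlenner2003

variable {n : ℕ}

/-- **Buchweitz–Flenner 2003, Thm. 5.1, GLOBAL form along an irreducible base, the special fibre given up to a model
isomorphism `e : X₀ ≅ 𝒳_{s₀}`** — theory seat 1's `BuchweitzFlenner2003.semiregular_deforms` re-run over the model
rendering of the named fact. Printed (p. 174 line 56 – p. 175 line 4): "Let `π : X → S` be a deformation of a compact
complex algebraic manifold `X₀` over a smooth germ `S = (S, 0)` […]. Assume that `(α_p)_{p∈I}` is a horizontal section in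
`∏_{p∈I} R^p π_*(Ω^p_{X/S})`. If there is an `I`-semiregular sheaf `ℰ₀` on `X₀` with `α_p(0) = ch_p(ℰ₀)`, `p ∈ I`, then
`α_p(s)` is algebraic for all `s ∈ S` near `0` and each `p ∈ I`"; a deformation OF `X₀` carries the identification of
`X₀` with `π⁻¹(0)` (Example 6.2, 7.18), rendered by `e`. RENDERING: for every Chern character theory `C`, smooth projective
family `f : 𝒳 ⟶ S` of relative dimension `n` (`𝒳`, `S` quasi-projective, `S` smooth irreducible), `s₀ ∈ S(ℂ)`, model
`e : X₀ ≅ 𝒳_{s₀}`, FINITE LOCALLY FREE `ℰ₀` on `X₀` with `(σ_{p−1})_{p∈I}` jointly injective, and global classes `W_p`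
(`p ∈ I`) of type `(p,p)` on every fibre with `e^*(W_p|_{𝒳_{s₀}}) = ch_p(ℰ₀)`: `W_p|_{𝒳_t}` is algebraic for every `p ∈ I`
and EVERY `t ∈ S(ℂ)`. Proof: as `semiregular_deforms` — Ehresmann (`R^{2p}f_*ℂ` a local system on `S(ℂ)`), the
transports of `(e⁻¹)^* ch_p(ℰ₀) = W_p|_{𝒳_{s₀}}` are the restrictions `W_p|_{𝒳_t}`, the fact gives an open `W' ∋ s₀`,
Bloch's countable-union step on the irreducible base spreads algebraicity from the path component of `s₀` in `W'` to
every `t`. Trust base: `hBF`, `hCS`. [cite: BuchweitzFlenner2003, §5 Thm. 5.1 pp. 174–175; §6 Example 6.2; 7.18]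
[cite: Bloch1972Semiregularity, proof of Thm. (7.4), last paragraph, p. 65] [cite: CharlesSchnell2014Notes, Prop. 11.3.11 (proof)] -/
theorem semiregular_deforms_model (hBF : BuchweitzFlenner2003_variationalHodge_ISemiregular_model)
    (hCS : charlesSchnell_algebraicityLocus_iUnion_closed) (C : ChernCharacterBetti)
    {𝒳 S : SchemeOver ℂ} (f : 𝒳 ⟶ S) (hf : IsSmoothProjectiveFamily f n) (h𝒳 : IsQuasiProjectiveOver 𝒳)
    (hS : IsQuasiProjectiveOver S) (hSm : AlgebraicGeometry.Smooth S.hom) [IrreducibleSpace S.left]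
    (s₀ : ComplexPoints S) (X₀ : SchemeOver ℂ) (e : X₀ ≅ fiberOver f s₀)
    (E₀ : X₀.left.Modules) (hE₀ : IsFiniteLocallyFree E₀) (I : Finset ℕ)
    (hsr : IsISemiregular hE₀ {q | q + 1 ∈ I})
    (W : (p : ℕ) → complexBetti 𝒳 (2 * p))
    (hW : ∀ p ∈ I, ∀ s : ComplexPoints S,
      IsOfHodgeType n (fiberOver f s) (2 * p) p p (Res[f, s, 2 * p, W p]))
    (hW₀ : ∀ p ∈ I, complexBetti.map e.hom (2 * p) (Res[f, s₀, 2 * p, W p]) = C.ch X₀ E₀ p)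
    {p : ℕ} (hp : p ∈ I) (t : ComplexPoints S) :
    Res[f, t, 2 * p, W p] ∈ algebraicClasses (fiberOver f t) p := by
  classical
  haveI := hSm
  haveI : LocallyOfFiniteType S.hom := hS.locallyOfFiniteType
  haveI : ConnectedSpace (ComplexPoints S) := (ComplexPoints.connectedSpace_iff_holds S).2 inferInstance
  -- `S(ℂ)` is a topological manifold of dimension `2d`, and `R^k f_* ℂ` is a local system on all of it
  obtain ⟨d, hd⟩ := exists_smoothOfRelativeDimension_of_connectedSpace_complexPoints S
  haveI := hd
  have hU : IsCohomologicallyLocallyTrivialOn f (Set.univ : Set (ComplexPoints S)) :=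
    isCohomologicallyLocallyTrivialOn_univ_of_isSmoothProjectiveFamily f d hf hS
  letI := ComplexPoints.chartedSpace S d
  haveI : LocallyPathConnectedSpace (ComplexPoints S) :=
    ChartedSpace.locallyPathConnectedSpace (EuclideanSpace ℝ (Fin (2 * d))) (ComplexPoints S)
  let s₀' : (Set.univ : Set (ComplexPoints S)) := ⟨s₀, Set.mem_univ s₀⟩
  -- `(e⁻¹)^* ch_p(ℰ₀) = W_p|_{𝒳_{s₀}}` for `p ∈ I`
  have hW₀' : ∀ p' ∈ I, complexBetti.map e.inv (2 * p') (C.ch X₀ E₀ p') = Res[f, s₀, 2 * p', W p'] := by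
    intro p' hp'
    rw [← hW₀ p' hp', e.complexBetti_map_inv_map_hom]
  -- BF's horizontality hypothesis: the transports of `(e⁻¹)^* ch_p(ℰ₀)` are the restrictions of `W_p`
  have hHodge : ∀ p' ∈ I, ∀ (t : (Set.univ : Set (ComplexPoints S)))
      (γ : Path.Homotopic.Quotient s₀' t),
      IsOfHodgeType n (fiberOver f t.1) (2 * p') p' p'
        (transportFun f (2 * p') hU γ (complexBetti.map e.inv (2 * p') (C.ch X₀ E₀ p'))) := by
    intro p' hp' t γ
    rw [hW₀' p' hp', transportFun_map_fiberι f (2 * p') hU γ (W p')]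
    exact hW p' hp' t.1
  obtain ⟨W', hWo, hW'₀, hWU, hW'⟩ := hBF C f n hf hSm hU s₀' X₀ e E₀ hE₀ I hsr hHodge
  -- algebraic on the (open) path component of `s₀` in `W'`
  have hV : ∀ t ∈ pathComponentIn W' s₀,
      Res[f, t, 2 * p, W p] ∈ algebraicClasses (fiberOver f t) p := by
    intro t ht
    have hj : JoinedIn W' s₀ t := ht
    let γ : Path (⟨s₀, hW'₀⟩ : W') ⟨t, pathComponentIn_subset ht⟩ :=
      { toFun := fun u ↦ ⟨hj.somePath u, hj.somePath_mem u⟩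
        continuous_toFun := hj.somePath.continuous.subtype_mk _
        source' := Subtype.ext hj.somePath.source
        target' := Subtype.ext hj.somePath.target }
    have hmem : transportFun f (2 * p) (hU.mono hWU hWo) ⟦γ⟧ (complexBetti.map e.inv (2 * p) (C.ch X₀ E₀ p)) ∈
        algebraicClasses (fiberOver f t) p := hW' p hp ⟨t, pathComponentIn_subset ht⟩ ⟦γ⟧
    have htr : transportFun f (2 * p) (hU.mono hWU hWo) ⟦γ⟧ (complexBetti.map e.inv (2 * p) (C.ch X₀ E₀ p)) =
        Res[f, t, 2 * p, W p] := by
      rw [hW₀' p hp]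
      exact transportFun_map_fiberι f (2 * p) (hU.mono hWU hWo) ⟦γ⟧ (W p)
    rwa [htr] at hmem
  exact hCS.forall_mem_algebraicClasses_of_isOpen f n p h𝒳 hS hSm hf (W p)
    (hWo.pathComponentIn s₀) ⟨s₀, mem_pathComponentIn_self hW'₀⟩ hV t

end BuchweitzFlenner2003

/-! ## 2. The chart / component forms of `ComponentTransferSheaf.lean`, one model -/

section SheafOn

variable {𝒴 M : SchemeOver ℂ} {g : 𝒴 ⟶ M} {𝒳 T : SchemeOver ℂ} {f : 𝒳 ⟶ T} {n p : ℕ}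

/-- **Transfer along a chart, sheaf representative ON A MODEL (BF 2003 Thm. 5.1 model rendering, global ∘ CDK chart).**
As `forall_mem_algebraicClasses_of_sweepsClasses_sheaf`, but the finite locally free `I`-semiregular `ℰ₀` lives on a
model `e : X₀ ≅ 𝒳_{u₀}` of the chart fibre and `e^*(W_{p'}|_{𝒳_{u₀}}) = ch_{p'}(ℰ₀)` (`p' ∈ I`); fact
`BuchweitzFlenner2003_variationalHodge_ISemiregular_model`. If `(f, W_p)` sweeps a set `A` of fibre classes of `g`
(`p ∈ I`), every class in `A` is algebraic. [cite: BuchweitzFlenner2003, §5 Thm. 5.1, pp. 174–175; §6 Example 6.2]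
[cite: Bloch1972Semiregularity, proof of Thm. (7.4), p. 65] [cite: CattaniDeligneKaplan1995JAMS, Thm. 1.1 and Cor. 1.2] -/
theorem forall_mem_algebraicClasses_of_sweepsClasses_sheafOn
    (hBF : BuchweitzFlenner2003_variationalHodge_ISemiregular_model) (Cc : ChernCharacterBetti)
    (hf : IsSmoothProjectiveFamily f n) (h𝒳 : IsQuasiProjectiveOver 𝒳) (hT : IsQuasiProjectiveOver T)
    (hTs : _root_.AlgebraicGeometry.Smooth T.hom) [IrreducibleSpace T.left]
    (u₀ : ComplexPoints T) (X₀ : SchemeOver ℂ) (e : X₀ ≅ fiberOver f u₀)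
    (E₀ : X₀.left.Modules) (hE₀ : IsFiniteLocallyFree E₀) (I : Finset ℕ)
    (hsr : IsISemiregular hE₀ {q | q + 1 ∈ I})
    (W : (p' : ℕ) → complexBetti 𝒳 (2 * p'))
    (hW : ∀ p' ∈ I, ∀ u : ComplexPoints T,
      IsOfHodgeType n (fiberOver f u) (2 * p') p' p' (Res[f, u, 2 * p', W p']))
    (hW₀ : ∀ p' ∈ I, complexBetti.map e.hom (2 * p') (Res[f, u₀, 2 * p', W p']) = Cc.ch X₀ E₀ p')
    (hp : p ∈ I) {A : Set (FiberClass g (2 * p))} (hsweep : SweepsClasses g f (W p) A) :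
    ∀ x ∈ A, x.cls ∈ algebraicClasses (fiberOver g x.pt) p :=
  fun _ hx => hsweep.mem_algebraicClasses
    (fun u => BuchweitzFlenner2003.semiregular_deforms_model hBF charlesSchnell_algebraicityLocus_iUnion_closed_holds Cc
      f hf h𝒳 hT hTs u₀ X₀ e E₀ hE₀ I hsr W hW hW₀ hp u) hx

/-- **Transfer along a chart, sheaf representative on a model, `q·hⁿ + w` shape**: as
`forall_mem_algebraicClasses_of_sweepsClasses_sheafOn`, the swept class being `V` with `W_p = a • V + b • L`, `a, b ∈ ℚ`,
`a ≠ 0`, `L` algebraic on every fibre (`V|_u = a⁻¹ • (W_p|_u - b • L|_u)`). [cite: BuchweitzFlenner2003, §5 Thm. 5.1, pp. 174–175]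
[cite: Markman2025SecantWeil, §1.5] -/
theorem forall_mem_algebraicClasses_of_sweepsClasses_sheafOn_of_smul_add
    (hBF : BuchweitzFlenner2003_variationalHodge_ISemiregular_model) (Cc : ChernCharacterBetti)
    (hf : IsSmoothProjectiveFamily f n) (h𝒳 : IsQuasiProjectiveOver 𝒳) (hT : IsQuasiProjectiveOver T)
    (hTs : _root_.AlgebraicGeometry.Smooth T.hom) [IrreducibleSpace T.left]
    (u₀ : ComplexPoints T) (X₀ : SchemeOver ℂ) (e : X₀ ≅ fiberOver f u₀)
    (E₀ : X₀.left.Modules) (hE₀ : IsFiniteLocallyFree E₀) (I : Finset ℕ)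
    (hsr : IsISemiregular hE₀ {q | q + 1 ∈ I})
    (W : (p' : ℕ) → complexBetti 𝒳 (2 * p'))
    (hW : ∀ p' ∈ I, ∀ u : ComplexPoints T,
      IsOfHodgeType n (fiberOver f u) (2 * p') p' p' (Res[f, u, 2 * p', W p']))
    (hW₀ : ∀ p' ∈ I, complexBetti.map e.hom (2 * p') (Res[f, u₀, 2 * p', W p']) = Cc.ch X₀ E₀ p')
    (hp : p ∈ I) (V L : complexBetti 𝒳 (2 * p)) (a b : ℚ) (ha : a ≠ 0)
    (hVL : W p = (a : ℂ) • V + (b : ℂ) • L)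
    (hLalg : ∀ u : ComplexPoints T, Res[f, u, 2 * p, L] ∈ algebraicClasses (fiberOver f u) p)
    {A : Set (FiberClass g (2 * p))} (hsweep : SweepsClasses g f V A) :
    ∀ x ∈ A, x.cls ∈ algebraicClasses (fiberOver g x.pt) p := by
  have ha' : (a : ℂ) ≠ 0 := by exact_mod_cast ha
  have hValg : ∀ u : ComplexPoints T, Res[f, u, 2 * p, V] ∈ algebraicClasses (fiberOver f u) p := by
    intro u
    have h1 : Res[f, u, 2 * p, W p] ∈ algebraicClasses (fiberOver f u) p :=
      BuchweitzFlenner2003.semiregular_deforms_model hBF charlesSchnell_algebraicityLocus_iUnion_closed_holds Cc f hf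
        h𝒳 hT hTs u₀ X₀ e E₀ hE₀ I hsr W hW hW₀ hp u
    rw [hVL, map_add, map_smul, map_smul] at h1
    have h2 : (a : ℂ) • Res[f, u, 2 * p, V] ∈ algebraicClasses (fiberOver f u) p := by
      have h3 := Submodule.sub_mem _ h1 (Submodule.smul_mem _ (b : ℂ) (hLalg u))
      rwa [add_sub_cancel_right] at h3
    have h4 := Submodule.smul_mem _ (a : ℂ)⁻¹ h2
    rwa [smul_smul, inv_mul_cancel₀ ha', one_smul] at h4
  exact fun x hx => hsweep.mem_algebraicClasses hValg hx

/-- **The transfer chain with a sheaf representative on a model, component form**: `A = C.carrier` in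
`forall_mem_algebraicClasses_of_sweepsClasses_sheafOn`. Inputs BY NAME: `hBF` (BF Thm. 5.1, model rendering), `hsweep`
(CDK chart). NOT inputs: CM-ness of the point, HC_CM, density, finiteness. [cite: BuchweitzFlenner2003, §5 Thm. 5.1, pp. 174–175]
[cite: CattaniDeligneKaplan1995JAMS, Thm. 1.1 and Cor. 1.2] -/
theorem hc_on_component_of_semiregular_sheafOn (hBF : BuchweitzFlenner2003_variationalHodge_ISemiregular_model)
    (Cc : ChernCharacterBetti) (C : HodgeLocusComponent g n p)
    (hf : IsSmoothProjectiveFamily f n) (h𝒳 : IsQuasiProjectiveOver 𝒳) (hT : IsQuasiProjectiveOver T)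
    (hTs : _root_.AlgebraicGeometry.Smooth T.hom) [IrreducibleSpace T.left]
    (u₀ : ComplexPoints T) (X₀ : SchemeOver ℂ) (e : X₀ ≅ fiberOver f u₀)
    (E₀ : X₀.left.Modules) (hE₀ : IsFiniteLocallyFree E₀) (I : Finset ℕ)
    (hsr : IsISemiregular hE₀ {q | q + 1 ∈ I})
    (W : (p' : ℕ) → complexBetti 𝒳 (2 * p'))
    (hW : ∀ p' ∈ I, ∀ u : ComplexPoints T,
      IsOfHodgeType n (fiberOver f u) (2 * p') p' p' (Res[f, u, 2 * p', W p']))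
    (hW₀ : ∀ p' ∈ I, complexBetti.map e.hom (2 * p') (Res[f, u₀, 2 * p', W p']) = Cc.ch X₀ E₀ p')
    (hp : p ∈ I) (hsweep : SweepsClasses g f (W p) C.carrier) :
    ∀ x ∈ C.carrier, x.cls ∈ algebraicClasses (fiberOver g x.pt) p :=
  forall_mem_algebraicClasses_of_sweepsClasses_sheafOn hBF Cc hf h𝒳 hT hTs u₀ X₀ e E₀ hE₀ I hsr W hW hW₀ hp hsweep

/-- **The transfer chain with a sheaf representative on a model, component form, `q·hⁿ + w` shape** (`W_p = a • V + b • L`,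
`a ≠ 0`, `L` fibrewise algebraic; the component is swept by `V`). [cite: BuchweitzFlenner2003, §5 Thm. 5.1, pp. 174–175]
[cite: Markman2025SecantWeil, §1.5] [cite: CattaniDeligneKaplan1995JAMS, Thm. 1.1 and Cor. 1.2] -/
theorem hc_on_component_of_semiregular_sheafOn_of_smul_add
    (hBF : BuchweitzFlenner2003_variationalHodge_ISemiregular_model) (Cc : ChernCharacterBetti)
    (C : HodgeLocusComponent g n p)
    (hf : IsSmoothProjectiveFamily f n) (h𝒳 : IsQuasiProjectiveOver 𝒳) (hT : IsQuasiProjectiveOver T)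
    (hTs : _root_.AlgebraicGeometry.Smooth T.hom) [IrreducibleSpace T.left]
    (u₀ : ComplexPoints T) (X₀ : SchemeOver ℂ) (e : X₀ ≅ fiberOver f u₀)
    (E₀ : X₀.left.Modules) (hE₀ : IsFiniteLocallyFree E₀) (I : Finset ℕ)
    (hsr : IsISemiregular hE₀ {q | q + 1 ∈ I})
    (W : (p' : ℕ) → complexBetti 𝒳 (2 * p'))
    (hW : ∀ p' ∈ I, ∀ u : ComplexPoints T,
      IsOfHodgeType n (fiberOver f u) (2 * p') p' p' (Res[f, u, 2 * p', W p']))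
    (hW₀ : ∀ p' ∈ I, complexBetti.map e.hom (2 * p') (Res[f, u₀, 2 * p', W p']) = Cc.ch X₀ E₀ p')
    (hp : p ∈ I) (V L : complexBetti 𝒳 (2 * p)) (a b : ℚ) (ha : a ≠ 0)
    (hVL : W p = (a : ℂ) • V + (b : ℂ) • L)
    (hLalg : ∀ u : ComplexPoints T, Res[f, u, 2 * p, L] ∈ algebraicClasses (fiberOver f u) p)
    (hsweep : SweepsClasses g f V C.carrier) :
    ∀ x ∈ C.carrier, x.cls ∈ algebraicClasses (fiberOver g x.pt) p :=
  forall_mem_algebraicClasses_of_sweepsClasses_sheafOn_of_smul_add hBF Cc hf h𝒳 hT hTs u₀ X₀ e E₀ hE₀ I hsr W hW hW₀ hp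
    V L a b ha hVL hLalg hsweep

end SheafOn

/-! ## 3. Door D2 on `𝒜_{g,δ,N}`, ONE object on ONE model -/

section Siegel

variable {g : ℕ} {δ : Fin g → ℕ} {N : ℕ}

/-- **Door D2 at one component, ONE MODEL** (Buchweitz–Flenner): granted the chart clause `SiegelHodgeLocusChartAt D p C`
and `BuchweitzFlenner2003_variationalHodge_ISemiregular_model` (BF Thm. 5.1, model rendering, refereed), a Chern character
theory `Cc`, a finite `I ∋ p`, global classes `Λ_{p'}` of the universal family fibrewise `(p',p')` for `p' ∈ I` with `Λ_p`
moreover fibrewise rational and algebraic, `(t₀, α₀) ∈ C`, rationals `a ≠ 0`, `b`, `c_{p'}`, and — on ONE model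
`e : X₀ ≅ 𝒴_{t₀}` — ONE finite locally free `I`-semiregular `ℰ₀` on `X₀` with `ch_p(ℰ₀) = e^*(a·α₀ + b·Λ_p|_{t₀})` and
`ch_{p'}(ℰ₀) = e^*(c_{p'}·Λ_{p'}|_{t₀})` (`p' ∈ I ∖ {p}`): `α` is algebraic for EVERY `(t, α) ∈ C`. Proof: the landed
every-model proof (`hc_on_siegelComponent_of_sheafSeed_of_smul_add_at`) with the chart fibre `𝒳_{u₀}` over `t₀` modelled
by `e ≫ e₀⁻¹ : X₀ ≅ 𝒴_{t₀} ≅ 𝒳_{u₀}` and `forall_mem_algebraicClasses_of_sweepsClasses_sheafOn_of_smul_add`. For the cell: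
`g = 2n`, `p = n`, `α₀ = w`, `Λ_{p'} = θ^{p'}`, `X₀` = the model the census row computed on.
[cite: BuchweitzFlenner2003, §5 Thm. 5.1; §6 Example 6.2] [cite: CattaniDeligneKaplan1995JAMS, Thm. 1.1 and Cor. 1.2]
[cite: Markman2025SecantWeil, §1.5] [cite: FultonYoungTableaux1997, Appendix B §B.1 (1)] -/
theorem hc_on_siegelComponent_of_sheafSeedOn_of_smul_add_at {p : ℕ} {D : SiegelModuliDatum g δ N}
    {C : HodgeLocusComponent D.f g p} (hA : SiegelHodgeLocusChartAt D p C)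
    (hBF : BuchweitzFlenner2003_variationalHodge_ISemiregular_model) (Cc : ChernCharacterBetti)
    (I : Finset ℕ) (hp : p ∈ I)
    (Λ : (p' : ℕ) → complexBetti D.𝒳 (2 * p'))
    (hΛ : ∀ p' ∈ I, ∀ s : ComplexPoints D.S, IsOfHodgeType g (fiberOver D.f s) (2 * p') p' p' (Res[D.f, s, 2 * p', Λ p']))
    (hΛp : ∀ s : ComplexPoints D.S, IsRationalClass (Res[D.f, s, 2 * p, Λ p]) ∧
      Res[D.f, s, 2 * p, Λ p] ∈ algebraicClasses (fiberOver D.f s) p)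
    {x₀ : FiberClass D.f (2 * p)} (hx₀ : x₀ ∈ C.carrier) (a b : ℚ) (ha : a ≠ 0) (c : ℕ → ℚ)
    (X₀ : SchemeOver ℂ) (e : X₀ ≅ fiberOver D.f x₀.pt)
    (E₀ : X₀.left.Modules) (hE₀ : IsFiniteLocallyFree E₀) (hsr : IsISemiregular hE₀ {q | q + 1 ∈ I})
    (hchp : Cc.ch X₀ E₀ p =
      complexBetti.map e.hom (2 * p) ((a : ℂ) • x₀.cls + (b : ℂ) • Res[D.f, x₀.pt, 2 * p, Λ p]))
    (hchp' : ∀ p' ∈ I, p' ≠ p →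
      Cc.ch X₀ E₀ p' = complexBetti.map e.hom (2 * p') (((c p' : ℚ) : ℂ) • Res[D.f, x₀.pt, 2 * p', Λ p'])) :
    ∀ x ∈ C.carrier, x.cls ∈ algebraicClasses (fiberOver D.f x.pt) p := by
  obtain ⟨𝒳, T, f, Φ, W, hf, h𝒳, hT, hTs, hTi, hW, hΦ, hsw⟩ := hA
  haveI := hTi
  -- the pulled-back companion classes `L_{p'} = Φ^*Λ_{p'}`: fibrewise `(p',p')`, and `L_p` algebraic on every chart fibre
  have hLfib : ∀ p' ∈ I, ∀ u : ComplexPoints T,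
      IsOfHodgeType g (fiberOver f u) (2 * p') p' p' (Res[f, u, 2 * p', complexBetti.map Φ (2 * p') (Λ p')]) := by
    intro p' hp' u
    obtain ⟨s, e', he'⟩ := hΦ u
    rw [← map_res_eq_res_map_of_comm e' he']
    exact (isOfHodgeType_map_iff_of_iso e').2 (hΛ p' hp' s)
  have hLalg : ∀ u : ComplexPoints T,
      Res[f, u, 2 * p, complexBetti.map Φ (2 * p) (Λ p)] ∈ algebraicClasses (fiberOver f u) p := by
    intro u
    obtain ⟨s, e', he'⟩ := hΦ u
    rw [← map_res_eq_res_map_of_comm e' he']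
    exact (mem_algebraicClasses_map_iff_of_iso e').2 (hΛp s).2
  -- the special point on the chart; the model `X₀ ≅ 𝒴_{t₀} ≅ 𝒳_{u₀}` of the chart fibre
  obtain ⟨u₀, e₀, he₀Φ, he₀⟩ := hsw x₀ hx₀
  have hcomp : ∀ (k : ℕ) (y : complexBetti (fiberOver f u₀) k),
      complexBetti.map (e ≪≫ e₀.symm).hom k y = complexBetti.map e.hom k (complexBetti.map e₀.inv k y) := by
    intro k y
    rw [Iso.trans_hom, Iso.symm_hom, complexBetti.map_comp]
    rfl
  -- the global classes of the chart in the degrees `p' ∈ I`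
  let Wfam : (p' : ℕ) → complexBetti 𝒳 (2 * p') :=
    Function.update (fun p' => ((c p' : ℚ) : ℂ) • complexBetti.map Φ (2 * p') (Λ p')) p
      ((a : ℂ) • W + (b : ℂ) • complexBetti.map Φ (2 * p) (Λ p))
  have hWp : Wfam p = (a : ℂ) • W + (b : ℂ) • complexBetti.map Φ (2 * p) (Λ p) := Function.update_self _ _ _
  have hWne : ∀ p', p' ≠ p → Wfam p' = ((c p' : ℚ) : ℂ) • complexBetti.map Φ (2 * p') (Λ p') :=
    fun p' hne => Function.update_of_ne hne _ _
  have hWhodge : ∀ p' ∈ I, ∀ u : ComplexPoints T,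
      IsOfHodgeType g (fiberOver f u) (2 * p') p' p' (Res[f, u, 2 * p', Wfam p']) := by
    intro p' hp' u
    rcases eq_or_ne p' p with rfl | hne
    · rw [hWp, map_add, map_smul, map_smul]
      exact ((hW u).2.smul (a : ℂ)).add (hf.isSmoothProjective u) ((hLfib p' hp u).smul (b : ℂ))
    · rw [hWne p' hne, map_smul]
      exact (hLfib p' hp' u).smul _
  -- `(e ≫ e₀⁻¹)^*(W_{p'}|_{𝒳_{u₀}}) = ch_{p'}(ℰ₀)`
  have hW₀ : ∀ p' ∈ I, complexBetti.map (e ≪≫ e₀.symm).hom (2 * p') (Res[f, u₀, 2 * p', Wfam p']) = Cc.ch X₀ E₀ p' := by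
    intro p' hp'
    rw [hcomp]
    rcases eq_or_ne p' p with rfl | hne
    · have h1 : Res[f, u₀, 2 * p', Wfam p'] =
          complexBetti.map e₀.hom (2 * p') ((a : ℂ) • x₀.cls + (b : ℂ) • Res[D.f, x₀.pt, 2 * p', Λ p']) := by
        rw [hWp, map_add, map_smul, map_smul, map_add, map_smul, map_smul, he₀, map_res_eq_res_map_of_comm e₀ he₀Φ]
      rw [h1, e₀.complexBetti_map_inv_map_hom, hchp]
    · have h1 : Res[f, u₀, 2 * p', Wfam p'] =
          complexBetti.map e₀.hom (2 * p') (((c p' : ℚ) : ℂ) • Res[D.f, x₀.pt, 2 * p', Λ p']) := by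
        rw [hWne p' hne, map_smul, map_smul, map_res_eq_res_map_of_comm e₀ he₀Φ]
      rw [h1, e₀.complexBetti_map_inv_map_hom, hchp' p' hp' hne]
  have hsweep : SweepsClasses D.f f W C.carrier := fun x hx => by
    obtain ⟨u, e', -, he'⟩ := hsw x hx
    exact ⟨u, e', he'⟩
  exact forall_mem_algebraicClasses_of_sweepsClasses_sheafOn_of_smul_add hBF Cc hf h𝒳 hT hTs u₀ X₀ (e ≪≫ e₀.symm) E₀ hE₀
    I hsr Wfam hWhodge hW₀ hp W (complexBetti.map Φ (2 * p) (Λ p)) a b ha hWp hLalg hsweep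

/-- **Door D2, one model, on base-chart data at the component** (`SiegelHodgeLocusBaseChartAt D p C`) **and Deligne's
théorème de la partie fixe**, through theory seat 3's `siegelHodgeLocusChartAt_of_baseChartAt`.
[cite: BuchweitzFlenner2003, §5 Thm. 5.1; §6 Example 6.2] [cite: DeligneHodgeII1971, Théorème 4.1.1]
[cite: MoonenOort2013Torelli, §3 Def. (Version 2) and (d)] -/
theorem hc_on_siegelComponent_of_sheafSeedOn_of_smul_add_of_baseChartAt {p : ℕ} {D : SiegelModuliDatum g δ N}
    {C : HodgeLocusComponent D.f g p} (hS : SiegelHodgeLocusBaseChartAt D p C)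
    (hGIC : deligne_globalInvariantCycles)
    (hBF : BuchweitzFlenner2003_variationalHodge_ISemiregular_model) (Cc : ChernCharacterBetti)
    (I : Finset ℕ) (hp : p ∈ I)
    (Λ : (p' : ℕ) → complexBetti D.𝒳 (2 * p'))
    (hΛ : ∀ p' ∈ I, ∀ s : ComplexPoints D.S, IsOfHodgeType g (fiberOver D.f s) (2 * p') p' p' (Res[D.f, s, 2 * p', Λ p']))
    (hΛp : ∀ s : ComplexPoints D.S, IsRationalClass (Res[D.f, s, 2 * p, Λ p]) ∧
      Res[D.f, s, 2 * p, Λ p] ∈ algebraicClasses (fiberOver D.f s) p)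
    {x₀ : FiberClass D.f (2 * p)} (hx₀ : x₀ ∈ C.carrier) (a b : ℚ) (ha : a ≠ 0) (c : ℕ → ℚ)
    (X₀ : SchemeOver ℂ) (e : X₀ ≅ fiberOver D.f x₀.pt)
    (E₀ : X₀.left.Modules) (hE₀ : IsFiniteLocallyFree E₀) (hsr : IsISemiregular hE₀ {q | q + 1 ∈ I})
    (hchp : Cc.ch X₀ E₀ p =
      complexBetti.map e.hom (2 * p) ((a : ℂ) • x₀.cls + (b : ℂ) • Res[D.f, x₀.pt, 2 * p, Λ p]))
    (hchp' : ∀ p' ∈ I, p' ≠ p →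
      Cc.ch X₀ E₀ p' = complexBetti.map e.hom (2 * p') (((c p' : ℚ) : ℂ) • Res[D.f, x₀.pt, 2 * p', Λ p'])) :
    ∀ x ∈ C.carrier, x.cls ∈ algebraicClasses (fiberOver D.f x.pt) p :=
  hc_on_siegelComponent_of_sheafSeedOn_of_smul_add_at (siegelHodgeLocusChartAt_of_baseChartAt hS hGIC) hBF Cc I hp Λ hΛ
    hΛp hx₀ a b ha c X₀ e E₀ hE₀ hsr hchp hchp'

/-- **Door D2, one model, universal chart form** (the one-model counterpart of
`hc_on_siegelComponent_of_sheafSeed_of_smul_add`): the chart assumption `SiegelHodgeLocusChart g δ N` for every datum,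
degree and component, used at `(D, p, C)` (`hA.chartAt D p C`). [cite: BuchweitzFlenner2003, §5 Thm. 5.1; §6 Example 6.2]
[cite: CattaniDeligneKaplan1995JAMS, Thm. 1.1 and Cor. 1.2] [cite: Markman2025SecantWeil, §1.5] -/
theorem hc_on_siegelComponent_of_sheafSeedOn_of_smul_add (hA : SiegelHodgeLocusChart g δ N) {p : ℕ}
    (hBF : BuchweitzFlenner2003_variationalHodge_ISemiregular_model) (Cc : ChernCharacterBetti)
    (D : SiegelModuliDatum g δ N) (C : HodgeLocusComponent D.f g p) (I : Finset ℕ) (hp : p ∈ I)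
    (Λ : (p' : ℕ) → complexBetti D.𝒳 (2 * p'))
    (hΛ : ∀ p' ∈ I, ∀ s : ComplexPoints D.S, IsOfHodgeType g (fiberOver D.f s) (2 * p') p' p' (Res[D.f, s, 2 * p', Λ p']))
    (hΛp : ∀ s : ComplexPoints D.S, IsRationalClass (Res[D.f, s, 2 * p, Λ p]) ∧
      Res[D.f, s, 2 * p, Λ p] ∈ algebraicClasses (fiberOver D.f s) p)
    {x₀ : FiberClass D.f (2 * p)} (hx₀ : x₀ ∈ C.carrier) (a b : ℚ) (ha : a ≠ 0) (c : ℕ → ℚ)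
    (X₀ : SchemeOver ℂ) (e : X₀ ≅ fiberOver D.f x₀.pt)
    (E₀ : X₀.left.Modules) (hE₀ : IsFiniteLocallyFree E₀) (hsr : IsISemiregular hE₀ {q | q + 1 ∈ I})
    (hchp : Cc.ch X₀ E₀ p =
      complexBetti.map e.hom (2 * p) ((a : ℂ) • x₀.cls + (b : ℂ) • Res[D.f, x₀.pt, 2 * p, Λ p]))
    (hchp' : ∀ p' ∈ I, p' ≠ p →
      Cc.ch X₀ E₀ p' = complexBetti.map e.hom (2 * p') (((c p' : ℚ) : ℂ) • Res[D.f, x₀.pt, 2 * p', Λ p'])) :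
    ∀ x ∈ C.carrier, x.cls ∈ algebraicClasses (fiberOver D.f x.pt) p :=
  hc_on_siegelComponent_of_sheafSeedOn_of_smul_add_at (hA.chartAt D p C) hBF Cc I hp Λ hΛ hΛp hx₀ a b ha c X₀ e E₀ hE₀
    hsr hchp hchp'

end Siegel

end Summit.Ventures.HSemireg

end
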